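import Summits.BirchSwinnertonDyer.BirchSwinnertonDyer.Theses.PrintCf2
import Summits.BirchSwinnertonDyer.BirchSwinnertonDyer.Theorems.PrintCf2RamifiedOffTYZLargeConductor
import Summits.BirchSwinnertonDyer.Rank1Residual.P2.CongruentNumberLevelTwoDoor
import Summits.BirchSwinnertonDyer.BirchSwinnertonDyer.Theorems.PrintCf2RamifiedOffTYZJumpOneIsogeny
import Summits.BirchSwinnertonDyer.BirchSwinnertonDyer.Theorems.PrintCf2RamifiedOffTYZSecondNormLawsPrints
import Summits.BirchSwinnertonDyer.BirchSwinnertonDyer.Theorems.PrintCf2RamifiedOffTYZTheoremAFirstNormSquare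
import Summits.BirchSwinnertonDyer.BirchSwinnertonDyer.Theorems.PrintCf2RamifiedOffTYZRemainderPrintedFamilies
import HarnessLib

/-!
# The three OPEN Kummer laws at `2` behind crux 20509 `PrintCf2.RamifiedOffTYZOfFacts` — NAMED CONJECTURES

Director-bsd g25 ruling (790)(B) (2026-08-31), on cruxlead-20509 g34's recommendation (memo
`Cruxes/RamifiedOffTYZOfFacts/Lines/offtyz_v7_KummerModule.md` rev 3, §5e): the three CONJECTURE-GRADE stubs of
the registered skeleton `Cruxes/RamifiedOffTYZOfFacts/Lines/offtyz_v14.lean` (sha16 `37de13e12ff38d9e`; 13 stubs,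
1 closed = THEOREM A) are recorded here as NAMED CONJECTURES of OUR THEORY (D-0014 / rule 4b: an unproven conjecture a
line leans on lives under `Summits/…/Theorems`, tagged `@[conjecture]`, never in `Literature`), with the stub TEXTS
VERBATIM.  Nothing is asserted: three `Prop`s.  They are NOT route items and this file performs NO route verb; the
skeleton's holder restates the three stubs BY NAME at its next legitimate re-registration (pattern of v9).

Honest reading carried to the wall (label only, count-neutral): **20509 / 23431 are closable only modulo these three
OPEN laws** (Heegner-point `2`-indivisibility behind the barrier `Q(32) = ℤ/2`,
`Literature.Barriers.BirchSwinnertonDyer.CMRankOneAtNonsplitTwo`); rung 0 of the `(1+i)`-ladder = THEOREM A is PROVED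
(`Theorems/PrintCf2RamifiedOffTYZTheoremAFirstNormSquare.lean`, p814853).

DOMAIN OF VALIDITY (common to all three, from the antecedents): the congruent-number family `E_n : y² = x³ − n²x`,
`n` square-free in the JUMP-ONE RANK-ONE CLASS of the off-TYZ ramified cell (`ord_{s=1} L(E_n,s) = 1`, `#Sel₂ = 2⁵`,
`#Sel₄ = 2⁶`, i.e. `4`-rank of the `2`-Selmer group ≥ 1); the KummerLaws §3 boundary: the laws say nothing on
`4`-rank-`0` rows (there rung 0 already fails, as the module picture predicts — kit j343157 PART 2: the 13 reported
«breaks» are exactly 13 four-rank-0 rows OUTSIDE the domain; 5/5 in-domain rows match).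

NUMERICAL STANDING (kit / census ids; numerics are evidence, not proof): LAW Z⁺ census 217/217 class rows
(cruxlead g28/g30 `KummerLaws` / `SecondNorm` memos, zclass identities); kit j342926 (g4) R2 16/17 @520 digits,
K3 2/2; kit j343060 (g5) R2 10/11 @520 digits; kit j343157 (g6) PART 1 LAW Z⁺ 15/19 rows decided, 0 breaks, PART 2
5/5 in-domain; kit j342176 (g0) 35/35 R2 + 2/2 three-prime.  No falsifier has fired on the stated domain.

BSD is not proved by any of this; 20509 / 23431 / 23432 OPEN; BSD is proved for no curve.
-/


open scoped Classical
open Summit.BirchSwinnertonDyer Summit.BirchSwinnertonDyer.BirchSwinnertonDyer.Theses.PrintCf2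
open Literature.NumberTheory.EllipticCurves Literature.NumberTheory.EllipticCurves.TianYuanZhang2017

namespace Summit.BirchSwinnertonDyer.PrintCf2.OffTYZKummerLaws

/-- **LAW Z⁺ — THE SECOND-NORM LAW on the visible R2 class rows, for the CM realisation** (= registered stub `stub_offTYZ_secondNormNonsquare_visR2` of `Lines/offtyz_v14.lean`, text VERBATIM).  Skeleton docstring of record: «STUB (CONJECTURE-GRADE; v10, reshaped v11): **THE SECOND-NORM LAW on the visible R2 class rows, FOR THE CM REALISATION** — granted 𝔅_ram, on
`n = lq` (`l ≡ 1`, `q ≡ 7 (mod 8)`, `(l/q) = 1`) with `ord_{s=1} L(E_n, s) = 1`, `#Sel₂(E_n) = 2⁵`, `#Sel₄(E_n) = 2⁶` and a VISIBLE generator of `A_n(ℚ)`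
modulo torsion (`X ∉ 2ℚ^{×2}`), for every package, every realisation CARRYING (S4) and norms `N₁, N₀` (`ι N₀ = ∏(t x₀ − 2ι(i)) = N_{H(i)/M}(x(z_n) − 2i)`)
with `[N₁] = 1`: `N₀ ∉ ℍ′_n^{×2}` and `N₀·i ∉ ℍ′_n^{×2}`.  EQUIVALENT to C⁺ on those rows granted THEOREM A (p802722 / p803014 §3 / p810804 §3); `√(x − 2i)`
is non-congruence (g29 (A3), g31 barrier `Q(32) = ℤ/2`).  Size L (= BSD₂ on the visible R2 class rows).»  OPEN conjecture; a `Prop`, nothing asserted; domain and numerics in the module docstring. -/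
@[conjecture] def LawZPlusSecondNormVisibleR2 : Prop :=
  (Literature.NumberTheory.EllipticCurves.rank_eq_analyticRank_of_analyticRank_le_one ∧ WeierstrassCurve.hasEntireLFunction_rat ∧ WeierstrassCurve.bsdRHS_eq_of_isIsogenous ∧ Literature.NumberTheory.EllipticCurves.bsdTriple_of_hasCM_of_L_one_ne_zero ∧ Literature.NumberTheory.EllipticCurves.TianYuanZhang2017.thm12_parity_of_scriptL' ∧ Literature.NumberTheory.EllipticCurves.Tian2014.thm13_rank_one_and_sha_odd ∧ Literature.NumberTheory.QuadraticFields.RedeiReichardt.redeiReichardt_fourTwoCard_classGroup ∧ Literature.NumberTheory.EllipticCurves.LiLiuTian2024.thm12_bsd_congruentNumberCurve ∧ Literature.NumberTheory.EllipticCurves.Monsky1990.cor515_rank_eq_one_and_card_selmerGroup_two ∧ Literature.NumberTheory.EllipticCurves.HeathBrown1994.monsky_card_selmerGroup_two_even ∧ Literature.NumberTheory.EllipticCurves.Tian2014.tian2014_system_sMinus_genus) →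
    ∀ (l q n : ℕ), l.Prime → q.Prime → l % 8 = 1 → q % 8 = 7 → IsSquare ((l : ℤ) : ZMod q) → n = l * q →
      (congruentNumberCurve n).analyticRank = 1 →
      Nat.card ((congruentNumberCurve n).selmerGroup 2) = 2 ^ 5 → Nat.card ((congruentNumberCurve n).selmerGroup 4) = 2 ^ 6 →
      (∃ (X Y : ℚ) (h : (Literature.NumberTheory.EllipticCurves.TianYuanZhang2017.W2.Atwo n).toAffine.Nonsingular X Y),
        (∀ P : (Literature.NumberTheory.EllipticCurves.TianYuanZhang2017.W2.Atwo n).toAffine.Point, ∃ m : ℤ, IsOfFinAddOrder (P - m • (WeierstrassCurve.Affine.Point.some X Y h : (Literature.NumberTheory.EllipticCurves.TianYuanZhang2017.W2.Atwo n).toAffine.Point))) ∧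
          ¬ ∃ s : ℚ, X = 2 * s ^ 2) →
      ∀ (D : GenusPointData n), D.Printed → D.CMPointCompositumPrinted → D.Thm35AtBlocks →
      ∀ (M : Type) (_ : Field M) (_ : NumberField M) (_ : IsGalois ℚ M) (ι : D.H →ₐ[ℚ] M) (x₀ y₀ : M)
        (h₀ : (curveA.baseChange M).toAffine.Nonsingular x₀ y₀) (Φ : Finset (M ≃ₐ[ℚ] M)),
        (WeierstrassCurve.Affine.Point.map (W' := curveA) ι (D.Z n) = ∑ t ∈ Φ, GenusPointData.galPtOver M t (.some x₀ y₀ h₀) ∧ Φ.card = gK n) →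
        (∀ t ∈ Φ, ¬ ((2 : ℕ) • GenusPointData.galPtOver M t (.some x₀ y₀ h₀) = 0 ∨ (2 : ℕ) • GenusPointData.galPtOver M t (.some x₀ y₀ h₀) = tauOne)) →
        (∀ g : M ≃ₐ[ℚ] M, D.TrivialOnLOver ι n g →
          ∃ π : Φ → Φ, Function.Bijective π ∧
            ∀ t : Φ, GenusPointData.galPtOver M g (GenusPointData.galPtOver M (t : M ≃ₐ[ℚ] M) (.some x₀ y₀ h₀)) =
              GenusPointData.galPtOver M (π t : M ≃ₐ[ℚ] M) (.some x₀ y₀ h₀)) →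
        SevenBlockCMValue (.some x₀ y₀ h₀) n →
        ∀ N₁ N₀ : D.H, ι N₁ = ∏ t ∈ Φ, (t : M ≃ₐ[ℚ] M) x₀ → ι N₀ = ∏ t ∈ Φ, ((t : M ≃ₐ[ℚ] M) x₀ - 2 * ι D.im) →
          WeierstrassCurve.Affine.sqClass N₁ = 1 → ¬ ((∃ s : D.H, N₀ = s ^ 2) ∨ ∃ s : D.H, N₀ * D.im = s ^ 2)

/-- **C⁺ ON THE INVISIBLE R2 CLASS ROWS** (= registered stub `stub_offTYZ_levelTwo_invisR2` of `Lines/offtyz_v14.lean`, text VERBATIM).  Skeleton docstring of record: «STUB (CONJECTURE-GRADE; v14 re-cut of the v10 remainder, part 1): **C⁺ ON THE INVISIBLE R2 CLASS ROWS** — granted 𝔅_ram, the text of C⁺ on the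
jump-one rank-one class rows of R2 shape (`n = lq`, `l ≡ 1`, `q ≡ 7 (mod 8)`, `(l/q) = 1`) that carry NO visible generator (every generator of `A_n(ℚ)` modulo
torsion has `X ∈ 2ℚ^{×2}`; numerically the cell `x32 ∧ S ∧ ¬T`, 11/11 census rows, `(1+i)`-adic valuation of `Z(lq)` exactly `2`).  Kernel criterion (g26
`GenusPeriodR2.levelTwo_iff_genusPeriod_R2[_delta]`, g31 `OnePlusILadder.levelTwo_iff_half_sq_and_not_fourDivisible_of_invisible_R2`): C⁺ there ⟺
«`Z(n) ∈ 2A(ℍ′_n) + tors` ∧ `Z(n) ∉ 4A(ℍ′_n) + tors`» — rungs 2–3 of the ladder, both behind the barrier `Q(32) = ℤ/2`.  Size L.»  OPEN conjecture; a `Prop`, nothing asserted; domain and numerics in the module docstring. -/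
@[conjecture] def LawLevelTwoInvisibleR2 : Prop :=
  (Literature.NumberTheory.EllipticCurves.rank_eq_analyticRank_of_analyticRank_le_one ∧ WeierstrassCurve.hasEntireLFunction_rat ∧ WeierstrassCurve.bsdRHS_eq_of_isIsogenous ∧ Literature.NumberTheory.EllipticCurves.bsdTriple_of_hasCM_of_L_one_ne_zero ∧ Literature.NumberTheory.EllipticCurves.TianYuanZhang2017.thm12_parity_of_scriptL' ∧ Literature.NumberTheory.EllipticCurves.Tian2014.thm13_rank_one_and_sha_odd ∧ Literature.NumberTheory.QuadraticFields.RedeiReichardt.redeiReichardt_fourTwoCard_classGroup ∧ Literature.NumberTheory.EllipticCurves.LiLiuTian2024.thm12_bsd_congruentNumberCurve ∧ Literature.NumberTheory.EllipticCurves.Monsky1990.cor515_rank_eq_one_and_card_selmerGroup_two ∧ Literature.NumberTheory.EllipticCurves.HeathBrown1994.monsky_card_selmerGroup_two_even ∧ Literature.NumberTheory.EllipticCurves.Tian2014.tian2014_system_sMinus_genus) →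
    ∀ (n : ℕ) [(congruentNumberCurve n).IsElliptic] [(congruentNumberCurve n).IsGloballyMinimal],
      Squarefree n → (n % 8 = 5 ∨ n % 8 = 6 ∨ n % 8 = 7) →
      (congruentNumberCurve n).analyticRank = 1 →
      Nat.card ((congruentNumberCurve n).selmerGroup 2) = 2 ^ 5 →
      Nat.card ((congruentNumberCurve n).selmerGroup 4) = 2 ^ 6 →
      (∃ l q : ℕ, l.Prime ∧ q.Prime ∧ l % 8 = 1 ∧ q % 8 = 7 ∧ IsSquare ((l : ℤ) : ZMod q) ∧ n = l * q) →
      ¬ (∃ (X Y : ℚ) (h : (Literature.NumberTheory.EllipticCurves.TianYuanZhang2017.W2.Atwo n).toAffine.Nonsingular X Y),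
            (∀ P : (Literature.NumberTheory.EllipticCurves.TianYuanZhang2017.W2.Atwo n).toAffine.Point, ∃ m : ℤ, IsOfFinAddOrder (P - m • (WeierstrassCurve.Affine.Point.some X Y h : (Literature.NumberTheory.EllipticCurves.TianYuanZhang2017.W2.Atwo n).toAffine.Point))) ∧
              ¬ ∃ s : ℚ, X = 2 * s ^ 2) →
      ∀ L : ℤ, IsScriptL n L → (2 : ℤ) ∣ L ∧ ¬ (4 : ℤ) ∣ L

/-- **C⁺ OFF R2 AND OFF THE PRINTED RANK-ONE FAMILIES** (= registered stub `stub_offTYZ_levelTwo_offR2` of `Lines/offtyz_v14.lean`, text VERBATIM).  Skeleton docstring of record: «STUB (CONJECTURE-GRADE; v14 re-cut of the v10 remainder, part 2): **C⁺ OFF R2 AND OFF THE PRINTED RANK-ONE FAMILIES** — granted 𝔅_ram, the text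
of C⁺ on the jump-one rank-one class rows that are NOT of R2 shape with `(l/q) = 1` (so: R1 rows `n = lm`, `m ≡ 5 (mod 8)`; `n ≡ 6 (mod 8)`; three or
more primes), EXCLUDING Monsky's Cor. 5.15 families (`IsCor515Family`, conjunct 9) and Tian's 2014 Thm. 1.3 families (conjunct 6), on which the
remainder is vacuous (`#Sel₂ = 8`, p816665).  Size L–XL.»  OPEN conjecture; a `Prop`, nothing asserted; domain and numerics in the module docstring. -/
@[conjecture] def LawLevelTwoOffR2 : Prop :=
  (Literature.NumberTheory.EllipticCurves.rank_eq_analyticRank_of_analyticRank_le_one ∧ WeierstrassCurve.hasEntireLFunction_rat ∧ WeierstrassCurve.bsdRHS_eq_of_isIsogenous ∧ Literature.NumberTheory.EllipticCurves.bsdTriple_of_hasCM_of_L_one_ne_zero ∧ Literature.NumberTheory.EllipticCurves.TianYuanZhang2017.thm12_parity_of_scriptL' ∧ Literature.NumberTheory.EllipticCurves.Tian2014.thm13_rank_one_and_sha_odd ∧ Literature.NumberTheory.QuadraticFields.RedeiReichardt.redeiReichardt_fourTwoCard_classGroup ∧ Literature.NumberTheory.EllipticCurves.LiLiuTian2024.thm12_bsd_congruentNumberCurve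 ∧ Literature.NumberTheory.EllipticCurves.Monsky1990.cor515_rank_eq_one_and_card_selmerGroup_two ∧ Literature.NumberTheory.EllipticCurves.HeathBrown1994.monsky_card_selmerGroup_two_even ∧ Literature.NumberTheory.EllipticCurves.Tian2014.tian2014_system_sMinus_genus) →
    ∀ (n : ℕ) [(congruentNumberCurve n).IsElliptic] [(congruentNumberCurve n).IsGloballyMinimal],
      Squarefree n → (n % 8 = 5 ∨ n % 8 = 6 ∨ n % 8 = 7) →
      (congruentNumberCurve n).analyticRank = 1 →
      Nat.card ((congruentNumberCurve n).selmerGroup 2) = 2 ^ 5 →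
      Nat.card ((congruentNumberCurve n).selmerGroup 4) = 2 ^ 6 →
      ¬ (∃ l q : ℕ, l.Prime ∧ q.Prime ∧ l % 8 = 1 ∧ q % 8 = 7 ∧ IsSquare ((l : ℤ) : ZMod q) ∧ n = l * q) →
      ¬ Literature.NumberTheory.EllipticCurves.Monsky1990.IsCor515Family n →
      ¬ (∃ (k : ℕ) (p : Fin (k + 1) → ℕ) (n₀ : ℕ) (K : Type) (_ : Field K) (_ : NumberField K),
            (∀ i, (p i).Prime) ∧ (∀ i, p i ≠ 2) ∧ Function.Injective p ∧ (∀ i, i ≠ 0 → p i % 8 = 1) ∧ n₀ = ∏ i, p i ∧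
            Literature.NumberTheory.EllipticCurves.Tian2014.IsQuadraticFieldOfSqrt K (-(2 * n₀ : ℤ)) ∧
            Literature.NumberTheory.EllipticCurves.Tian2014.Condition11 n₀ K ∧ (n = n₀ ∨ n = 2 * n₀)) →
      ∀ L : ℤ, IsScriptL n L → (2 : ℤ) ∣ L ∧ ¬ (4 : ℤ) ∣ L

end Summit.BirchSwinnertonDyer.PrintCf2.OffTYZKummerLaws
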